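/-
Copyright (c) 2026 the pub-hodgecm-mathlib formalisation cell (harness21).  Prover seat hodgecm-mathlib-LH4-p02 (g8), on JAC-loc road holder LH6-p03 (g5)'s NAME
(2026-09-02T14:22:45Z): brick (J5a∕c) «NEWTON CLOSURE» of `F0/P3b/LH6-p03/g5/ROAD-JAC-LOC.v2.LH6p03g5.md` §2∕§5.
-/
import Mathlib.Topology.Algebra.Group.Basic
import HarnessLib

/-!
# Successive approximation in a topological group: a point approximated by a closed (e.g. compact-image) set modulo a shrinking family of sets lies in it
# (Bourbaki, *General Topology* III §2–§3; the closure step of every Hensel∕Newton iteration in a `p`-adic group)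

Topic `Topology/Algebra`; namespace `Literature.Topology.Algebra`.  THEOREMS ONLY (no definition, no instance, no notation, no named fact, no `sorry`; Mathlib-only imports;
axioms ⊆ {propext, Classical.choice, Quot.sound}).  Cell `pub/hodgecm-mathlib` (D-0151), crux H413 = `stmt-HodgeConjecture-24833`; half A line LH6 (closer stub `stub_StCharTS`, leaf
`Cruxes/H413/Lines/F0_P3c_StCharTSPaydown.lean`, organ (S-𝔇) `stub_EllipticPackage`), road «JAC-LOC» v2 (LH6-p03 (g5), sha16 0f77e4ca725b73b1) brick **(J5a∕c) «NEWTON CLOSURE»**: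
after the Newton iteration (J5b) has produced, for every level `K_{εθⁿ}` of a neighbourhood basis of `1`, an element `k s τ k⁻¹` of the orbit tube with `p ∈ (k s τ k⁻¹)·K_{εθⁿ}` —
equivalently `k s τ k⁻¹ ∈ p·K_{εθⁿ}` — the point `p` lies in the (compact, hence closed) image `Ad(K_γ)(sT_γ)` itself.  Lane `--kind proof --supports stmt-HodgeConjecture-24833`;
count-neutral.  HONEST LABEL: HC_CM is proved only modulo the 7 printed citations (2 remaining named inputs: hLiu418 = stmt-HodgeConjecture-24832, h413 = stmt-HodgeConjecture-24833)
until rung 0 closes; generic point-set topology.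

STATEMENTS.  `G` a topological group; `Kn : ι → Set G` ANY family with `∀ W ∈ 𝓝 1, ∃ n, Kn n ⊆ W` (a neighbourhood basis of `1` indexed by `ℕ` in the application — the `Kn n` need
not be neighbourhoods, nor nested, nor subgroups).
* `mem_of_isClosed_of_forall_exists_mem_leftCoset` — THE CORE: `C` closed, `∀ n, ∃ c ∈ C, c ∈ p·Kn n` ⇒ `p ∈ C` (for `U ∈ 𝓝 p` the set `{g | p·g ∈ U}` is a neighbourhood of
  `1`, so contains some `Kn n`, so `U` meets `C`; `C = closure C`).  Right-coset twin `mem_of_isClosed_of_forall_exists_mem_rightCoset` (`c ∈ Kn n · p`).  No separation axiom.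
* `mem_image_of_isCompact_of_forall_exists_mem_leftCoset` — `G` Hausdorff, `s` compact, `f` continuous on `s`, `∀ n, ∃ x ∈ s, f x ∈ p·Kn n` ⇒ `p ∈ f '' s` (the image is compact,
  hence closed); `CompactSpace` form `mem_range_of_forall_exists_mem_leftCoset` (`p ∈ Set.range f`) — the letter of the road memo: «`X` compact, `f : X → G` continuous, `p : G`,
  `Kn : ℕ → Set G` with `∀ W ∈ 𝓝 1, ∃ n, Kn n ⊆ W`, and `∀ n, ∃ x, f x ∈ (p * ·) '' Kn n` ⇒ `p ∈ f '' X`»; right-coset twins.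
* `mem_of_isClosed_of_forall_nhds_exists_inv_mul_mem` — the basis-free phrasing `∀ W ∈ 𝓝 1, ∃ c ∈ C, p⁻¹ * c ∈ W ⇒ p ∈ C`; `mem_range_of_forall_exists_mem_leftCoset_symm` — the approximate-solution phrasing `p ∈ f x · Kn n` for symmetric `Kn n`.

## References
* [BourbakiGT1] N. Bourbaki, *General Topology*, Ch. III §2 n° 1 (neighbourhoods of a point in a topological group are translates of neighbourhoods of `e`), Ch. I §9 n° 4
  (compact subsets of Hausdorff spaces are closed), Ch. III §3.
* [Casselman1995] W. Casselman, *Introduction to the theory of admissible representations of p-adic reductive groups* (draft 1995), §1.4 (the `K_m` as a neighbourhood basis of `1`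
  — the family `Kn` of the application).
-/

set_option autoImplicit false

namespace Literature.Topology.Algebra

open _root_.Topology _root_.Filter Set

section Closed

variable {G : Type*} [TopologicalSpace G] [Group G] [IsTopologicalGroup G] {ι : Sort*}

/-- **THE CORE (left cosets)**: in a topological group, if `C` is CLOSED, `Kn` is a family of sets every neighbourhood of `1` contains one of, and for every `n` some `c ∈ C` lies
in the left translate `p · Kn n`, then `p ∈ C`.  No separation axiom, no compactness. [cite: BourbakiGT1, Ch. III §2 n° 1] -/
theorem mem_of_isClosed_of_forall_exists_mem_leftCoset {C : Set G} (hC : IsClosed C) {p : G} (Kn : ι → Set G)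
    (hK : ∀ W ∈ 𝓝 (1 : G), ∃ n, Kn n ⊆ W) (h : ∀ n, ∃ c ∈ C, c ∈ (fun g => p * g) '' Kn n) : p ∈ C := by
  rw [← hC.closure_eq, mem_closure_iff_nhds]
  intro U hU
  have hW : (fun g => p * g) ⁻¹' U ∈ 𝓝 (1 : G) := by
    have ht := (continuous_const_mul p).tendsto (1 : G)
    rw [mul_one] at ht
    exact ht hU
  obtain ⟨n, hn⟩ := hK _ hW
  obtain ⟨c, hcC, g, hg, rfl⟩ := h n
  exact ⟨_, hn hg, hcC⟩

/-- THE CORE (right cosets): `C` closed, `∀ n, ∃ c ∈ C, c ∈ Kn n · p` ⇒ `p ∈ C`. [cite: BourbakiGT1, Ch. III §2 n° 1] -/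
theorem mem_of_isClosed_of_forall_exists_mem_rightCoset {C : Set G} (hC : IsClosed C) {p : G} (Kn : ι → Set G)
    (hK : ∀ W ∈ 𝓝 (1 : G), ∃ n, Kn n ⊆ W) (h : ∀ n, ∃ c ∈ C, c ∈ (fun g => g * p) '' Kn n) : p ∈ C := by
  rw [← hC.closure_eq, mem_closure_iff_nhds]
  intro U hU
  have hW : (fun g => g * p) ⁻¹' U ∈ 𝓝 (1 : G) := by
    have ht := (continuous_mul_const p).tendsto (1 : G)
    rw [one_mul] at ht
    exact ht hU
  obtain ⟨n, hn⟩ := hK _ hW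
  obtain ⟨c, hcC, g, hg, rfl⟩ := h n
  exact ⟨_, hn hg, hcC⟩

/-- The basis-free phrasing (left): `C` closed and `∀ W ∈ 𝓝 1, ∃ c ∈ C, p⁻¹ * c ∈ W` ⇒ `p ∈ C`. [cite: BourbakiGT1, Ch. III §2 n° 1] -/
theorem mem_of_isClosed_of_forall_nhds_exists_inv_mul_mem {C : Set G} (hC : IsClosed C) {p : G} (h : ∀ W ∈ 𝓝 (1 : G), ∃ c ∈ C, p⁻¹ * c ∈ W) : p ∈ C := by
  refine mem_of_isClosed_of_forall_exists_mem_leftCoset hC (fun W : {W : Set G // W ∈ 𝓝 (1 : G)} => (W : Set G)) (fun W hW => ⟨⟨W, hW⟩, subset_rfl⟩) fun W => ?_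
  obtain ⟨c, hcC, hcW⟩ := h W.1 W.2
  exact ⟨c, hcC, p⁻¹ * c, hcW, mul_inv_cancel_left p c⟩

end Closed

section Compact

variable {G : Type*} [TopologicalSpace G] [Group G] [IsTopologicalGroup G] [T2Space G] {X : Type*} [TopologicalSpace X] {ι : Sort*}

/-- **(J5a∕c) «NEWTON CLOSURE», compact-set form**: `G` a Hausdorff topological group, `s ⊆ X` compact, `f` continuous on `s`; if for every `n` some `x ∈ s` has `f x ∈ p · Kn n`,
where every neighbourhood of `1` contains some `Kn n`, then `p ∈ f '' s` (the image is compact, hence closed, and the core lemma applies). [cite: BourbakiGT1, Ch. I §9 n° 4; Ch. III §2 n° 1]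
[cite: Casselman1995, §1.4] -/
theorem mem_image_of_isCompact_of_forall_exists_mem_leftCoset {s : Set X} (hs : IsCompact s) {f : X → G} (hf : ContinuousOn f s) {p : G}
    (Kn : ι → Set G) (hK : ∀ W ∈ 𝓝 (1 : G), ∃ n, Kn n ⊆ W) (h : ∀ n, ∃ x ∈ s, f x ∈ (fun g => p * g) '' Kn n) : p ∈ f '' s :=
  mem_of_isClosed_of_forall_exists_mem_leftCoset ((hs.image_of_continuousOn hf).isClosed) Kn hK fun n => by
    obtain ⟨x, hx, hfx⟩ := h n
    exact ⟨f x, mem_image_of_mem f hx, hfx⟩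

/-- (J5a∕c), right cosets: same with `f x ∈ Kn n · p`. [cite: BourbakiGT1, Ch. I §9 n° 4; Ch. III §2 n° 1] -/
theorem mem_image_of_isCompact_of_forall_exists_mem_rightCoset {s : Set X} (hs : IsCompact s) {f : X → G} (hf : ContinuousOn f s) {p : G}
    (Kn : ι → Set G) (hK : ∀ W ∈ 𝓝 (1 : G), ∃ n, Kn n ⊆ W) (h : ∀ n, ∃ x ∈ s, f x ∈ (fun g => g * p) '' Kn n) : p ∈ f '' s :=
  mem_of_isClosed_of_forall_exists_mem_rightCoset ((hs.image_of_continuousOn hf).isClosed) Kn hK fun n => by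
    obtain ⟨x, hx, hfx⟩ := h n
    exact ⟨f x, mem_image_of_mem f hx, hfx⟩

/-- **(J5a∕c) «NEWTON CLOSURE», the road memo's letter**: `X` compact, `f : X → G` continuous into a Hausdorff topological group, `p : G`, `Kn` a family (e.g. `ℕ → Set G`) with
`∀ W ∈ 𝓝 1, ∃ n, Kn n ⊆ W`, and `∀ n, ∃ x, f x ∈ (p * ·) '' Kn n`; then `p ∈ Set.range f` (`= f '' univ`). [cite: BourbakiGT1, Ch. I §9 n° 4; Ch. III §2 n° 1] [cite: Casselman1995, §1.4] -/
theorem mem_range_of_forall_exists_mem_leftCoset [CompactSpace X] {f : X → G} (hf : Continuous f) {p : G} (Kn : ι → Set G)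
    (hK : ∀ W ∈ 𝓝 (1 : G), ∃ n, Kn n ⊆ W) (h : ∀ n, ∃ x, f x ∈ (fun g => p * g) '' Kn n) : p ∈ Set.range f := by
  rw [← image_univ]
  exact mem_image_of_isCompact_of_forall_exists_mem_leftCoset isCompact_univ hf.continuousOn Kn hK fun n => by
    obtain ⟨x, hfx⟩ := h n
    exact ⟨x, mem_univ x, hfx⟩

/-- The memo's letter with `f '' univ` spelled out. [cite: BourbakiGT1, Ch. I §9 n° 4; Ch. III §2 n° 1] -/
theorem mem_image_univ_of_forall_exists_mem_leftCoset [CompactSpace X] {f : X → G} (hf : Continuous f) {p : G} (Kn : ι → Set G)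
    (hK : ∀ W ∈ 𝓝 (1 : G), ∃ n, Kn n ⊆ W) (h : ∀ n, ∃ x, f x ∈ (fun g => p * g) '' Kn n) : p ∈ f '' univ := by
  rw [image_univ]
  exact mem_range_of_forall_exists_mem_leftCoset hf Kn hK h

/-- Right-coset range form: `∀ n, ∃ x, f x ∈ Kn n · p` ⇒ `p ∈ Set.range f`. [cite: BourbakiGT1, Ch. I §9 n° 4; Ch. III §2 n° 1] -/
theorem mem_range_of_forall_exists_mem_rightCoset [CompactSpace X] {f : X → G} (hf : Continuous f) {p : G} (Kn : ι → Set G)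
    (hK : ∀ W ∈ 𝓝 (1 : G), ∃ n, Kn n ⊆ W) (h : ∀ n, ∃ x, f x ∈ (fun g => g * p) '' Kn n) : p ∈ Set.range f := by
  rw [← image_univ]
  exact mem_image_of_isCompact_of_forall_exists_mem_rightCoset isCompact_univ hf.continuousOn Kn hK fun n => by
    obtain ⟨x, hfx⟩ := h n
    exact ⟨x, mem_univ x, hfx⟩

/-- The APPROXIMATE-SOLUTION phrasing used by a Newton iteration: if for every `n` there is `x` with `p ∈ f x · Kn n` (the error `(f x)⁻¹ p` lies in `Kn n`) then `p = f x` for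
some `x` — provided the `Kn n` are SYMMETRIC (`g ∈ Kn n → g⁻¹ ∈ Kn n`, e.g. subgroups), which turns `p ∈ f x · Kn n` into `f x ∈ p · Kn n`. [cite: BourbakiGT1, Ch. III §2 n° 1]
[cite: Casselman1995, §1.4] -/
theorem mem_range_of_forall_exists_mem_leftCoset_symm [CompactSpace X] {f : X → G} (hf : Continuous f) {p : G} (Kn : ι → Set G)
    (hK : ∀ W ∈ 𝓝 (1 : G), ∃ n, Kn n ⊆ W) (hsymm : ∀ n, ∀ g ∈ Kn n, g⁻¹ ∈ Kn n) (h : ∀ n, ∃ x, p ∈ (fun g => f x * g) '' Kn n) : p ∈ Set.range f :=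
  mem_range_of_forall_exists_mem_leftCoset hf Kn hK fun n => by
    obtain ⟨x, g, hg, hgp⟩ := h n
    refine ⟨x, g⁻¹, hsymm n g hg, ?_⟩
    rw [← hgp]
    exact mul_inv_cancel_right (f x) g

end Compact

end Literature.Topology.Algebra
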